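import Literature.AlgebraicGeometry.Frobenioids.BaseSectionsOfObjectsCor57FSM
import Literature.AlgebraicGeometry.Frobenioids.Cor411iiAssemblyFSM
import HarnessLib

/-!
# Frobenioids I, Corollary 5.7 (Category-theoreticity of Base-Sections) (i)–(iv) over bases of FSM-type
# with NO residual hypothesis

Mochizuki, *The geometry of Frobenioids I: the general theory*, Kyushu J. Math. **62** (2008)
293–400, Cor. 5.7 (i)–(iv) pp. 107–108, proof p. 108 ll. 15–21: "sorting through the definitions, to verify
assertions (i), (ii), (iii), (iv) it suffices to show that `Ψ` preserves isotropic objects, prime-Frobenius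
morphisms, pull-back morphisms, birationalizations, the natural projection functor `C_i → D_i` [hence, in
particular, the units `O^×(−)`], and … Frobenius degrees. But this follows from Theorem 3.4, (i), (iii);
Corollary 4.10; Corollary 4.11, (ii)." [cite: MochizukiFrdI2008, Cor. 5.7 p.107]

PROOF-ONLY companion of `BaseSectionsOfObjects.lean` (statements, seat abc-iut-L1-t5), abc-iut cell, seat
abc-iut-f-023 (FACT-LIST rows F-0939 `Cor57iii`, F-0940 `Cor57iv`; also (i), (ii)). The tree holds:

* abc-iut-L1-d6's proofs of Cor. 5.7 (i)–(iv) modulo the typed per-instance [FrdI] Thm. 3.4 (ii)/(iii) and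
  Cor. 4.11 (ii) for `Ψ` (`BaseSectionsOfObjectsCor57Proofs.lean`, `…Cor57bProofs.lean`);
* abc-iut-w4-d086's discharge of the Thm. 3.4 inputs over bases of FSM-type, leaving Cor. 5.7 (i), (iii), (iv)
  conditional ONLY on the typed per-instance Cor. 4.11 (ii) (`cor57i_sections_of_isOfFSMType`,
  `cor57i_pairs_of_isOfFSMType`, `isOfPreModelType_iff_of_isOfFSMType`, `cor57iii_of_isOfFSMType`,
  `cor57iv_of_isOfFSMType`, file `BaseSectionsOfObjectsCor57FSM.lean`; (ii) is `cor57ii_of_cor411ii`);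
* abc-iut-L1-d6's Cor. 4.11 (ii) AS TYPED over bases of FSM-type with `Φ_i` perf-factorial, unconditional
  (`cor411ii_ofFunctor_of_isOfFSMType`, file `Cor411iiAssemblyFSM.lean`, apex of the cell sub-DAG
  `plan/L1/SUBDAG-FrdI-Cor411.md`).

Since the standing hypotheses `Cor57Hypotheses` of the typed Cor. 5.7 CONTAIN "`C_i` is a Frobenioid" and
"`Φ_i` is perf-factorial", the last item supplies the Cor. 4.11 (ii) binder of the second: this file records the
composition — [FrdI] Cor. 5.7 (i) [base-sections, quasi-base-Frobenius pairs, the pre-model half of "model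
type"], (ii), (iii), (iv) AS TYPED, for every equivalence `Ψ : C₁ ⥲ C₂` of Frobenioids over bases `D₁`, `D₂`
of FSM-type, with no hypothesis left beyond FSM-type (the instance family the abc-iut cone cites:
`Summits/ABC/IUTFork/DAGL1t.lean`, nodes `N_FrdI_Cor5_7_i/iii/iv`; every IUT application has Galois-category /
temperoid bases, which are of FSM-type). The universal closures of the typed `Cor57iii` / `Cor57iv` (bases of
FSMFF-type only, through "standard type" (d)) are `cor57iii_of_facts` / `cor57iv_of_facts` and wait on the
cell's 0-ary named facts `FrdI.Thm34iii`, `FrdI.Cor411ii` (`FrdI.Thm34ii`).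

Nothing here is specific to the abc programme; no statement of the paper is restated or strengthened; no new
definition; nothing bears on, or takes a side on, [IUTchIII] Cor. 3.12.
-/

namespace Literature.AlgebraicGeometry.Frobenioids

open CategoryTheory Opposite

universe w v v' u u'

namespace PreFrobenioid

section Cor57FSMHolds

variable {D₁ : Type u} [Category.{v} D₁] {Φ₁ : D₁ᵒᵖ ⥤ CommMonCat.{w}}
  {C₁ : Type u'} [Category.{v'} C₁] (F₁ : C₁ ⥤ ElemFrobenioid Φ₁)
  {D₂ : Type u} [Category.{v} D₂] {Φ₂ : D₂ᵒᵖ ⥤ CommMonCat.{w}}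
  {C₂ : Type u'} [Category.{v'} C₂] (F₂ : C₂ ⥤ ElemFrobenioid Φ₂) (Ψ : C₁ ≌ C₂)

/-! ### The Cor. 4.11 (ii) binder from the hypotheses of Cor. 5.7, over FSM-type bases -/

/-- The standing hypotheses of Cor. 5.7 are symmetric in `(C₁, Ψ)` and `(C₂, Ψ⁻¹)` ("both `Ψ` and some
quasi-inverse to `Ψ` preserve base-isomorphisms", p. 108). [cite: MochizukiFrdI2008, Cor. 5.7 p.107] -/
theorem Cor57Hypotheses.symm {Ψ : C₁ ≌ C₂} (hyp : Cor57Hypotheses F₁ F₂ Ψ) : Cor57Hypotheses F₂ F₁ Ψ.symm where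
  isFrobenioid₁ := hyp.isFrobenioid₂
  isFrobenioid₂ := hyp.isFrobenioid₁
  perfFactorial₁ := hyp.perfFactorial₂
  perfFactorial₂ := hyp.perfFactorial₁
  divSlim₁ := hyp.divSlim₂
  divSlim₂ := hyp.divSlim₁
  standard₁ := hyp.standard₂
  standard₂ := hyp.standard₁
  baseIso_functor g₂ g₁ := hyp.baseIso_inverse g₁ g₂
  baseIso_inverse g₂ g₁ := hyp.baseIso_functor g₁ g₂

/-- **The typed [FrdI] Cor. 4.11 (ii) for `Ψ` HOLDS under the hypotheses of Cor. 5.7 over bases of FSM-type**: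
`Cor57Hypotheses` provides "`C_i` is a Frobenioid" and "`Φ_i` is perf-factorial", so abc-iut-L1-d6's
`cor411ii_ofFunctor_of_isOfFSMType` applies (its own antecedent `Cor411Setting` — Div-slim, standard type,
hypothesis (b) — is part of the typed `Cor411ii`). This is the binder "Corollary 4.11, (ii)" of the printed
proof of Cor. 5.7 (p. 108 l. 21). [cite: MochizukiFrdI2008, Cor. 4.11 (ii) p.91] -/
theorem Cor57Hypotheses.cor411ii_of_isOfFSMType {Ψ : C₁ ≌ C₂} (hyp : Cor57Hypotheses F₁ F₂ Ψ)
    (hD₁ : IsOfFSMType D₁) (hD₂ : IsOfFSMType D₂) :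
    (PreFrobenioidData.ofFunctor Φ₁ F₁).Cor411ii (PreFrobenioidData.ofFunctor Φ₂ F₂) Ψ :=
  cor411ii_ofFunctor_of_isOfFSMType hyp.isFrobenioid₁ hyp.isFrobenioid₂ Ψ hyp.perfFactorial₁ hyp.perfFactorial₂
    hD₁ hD₂

/-! ### Cor. 5.7 (i)–(iv) over bases of FSM-type, no residual hypothesis -/

/-- **[FrdI] Cor. 5.7 (i), base-sections, over bases of FSM-type — no residual hypothesis**: "`Ψ` maps
base-sections … of `C₁` to base-sections … of `C₂`" (the typed `Cor57i_sections F₁ F₂ Ψ`), for Frobenioids over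
bases `D₁`, `D₂` of FSM-type. [cite: MochizukiFrdI2008, Cor. 5.7 (i) p.107] -/
theorem cor57i_sections_holds_of_isOfFSMType (hD₁ : IsOfFSMType D₁) (hD₂ : IsOfFSMType D₂) :
    Cor57i_sections F₁ F₂ Ψ := fun hyp =>
  cor57i_sections_of_isOfFSMType F₁ F₂ Ψ hD₁ hD₂ (hyp.cor411ii_of_isOfFSMType F₁ F₂ hD₁ hD₂) hyp

/-- **[FrdI] Cor. 5.7 (i), quasi-base-Frobenius pairs, over bases of FSM-type — no residual hypothesis**: "`Ψ`
maps … quasi-base-Frobenius pairs of `C₁` to … quasi-base-Frobenius pairs of `C₂`" (the typed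
`Cor57i_pairs F₁ F₂ Ψ`: the Frobenius-sections match up to the automorphism `Ψ^{N_{≥1}}` of `N_{≥1}`).
[cite: MochizukiFrdI2008, Cor. 5.7 (i) p.107] -/
theorem cor57i_pairs_holds_of_isOfFSMType (hD₁ : IsOfFSMType D₁) (hD₂ : IsOfFSMType D₂) :
    Cor57i_pairs F₁ F₂ Ψ := fun hyp =>
  cor57i_pairs_of_isOfFSMType F₁ F₂ Ψ hD₁ hD₂ (hyp.cor411ii_of_isOfFSMType F₁ F₂ hD₁ hD₂) hyp

/-- **[FrdI] Cor. 5.7 (i), "In particular, `C₁` is of model type if and only if `C₂` is" — the pre-model half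
(Def. 2.7 (iii): existence of a base-Frobenius pair; the first conjunct of the typed `Cor57i_model`), over bases
of FSM-type — no residual hypothesis** (Cor. 4.11 (ii) for `Ψ` and for `Ψ⁻¹`). The Def. 4.5 (i) conjunct of
`Cor57i_model` is a schema in free birationalization data `B₁`, `B₂` and is not asserted.
[cite: MochizukiFrdI2008, Cor. 5.7 (i) p.108] -/
theorem cor57i_isOfPreModelType_iff_of_isOfFSMType (hD₁ : IsOfFSMType D₁) (hD₂ : IsOfFSMType D₂)
    (hyp : Cor57Hypotheses F₁ F₂ Ψ) : IsOfPreModelType F₁ ↔ IsOfPreModelType F₂ :=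
  isOfPreModelType_iff_of_isOfFSMType F₁ F₂ Ψ hD₁ hD₂ (hyp.cor411ii_of_isOfFSMType F₁ F₂ hD₁ hD₂)
    ((hyp.symm F₁ F₂).cor411ii_of_isOfFSMType F₂ F₁ hD₂ hD₁) hyp

/-- **[FrdI] Cor. 5.7 (ii) over bases of FSM-type — no residual hypothesis**: "`C₁` is of unit-profinite type
if and only if `C₂` is" (the typed `Cor57ii F₁ F₂ Ψ`; abc-iut-L1-d6's `cor57ii_of_cor411ii` with its Cor. 4.11 (ii)
binder supplied). [cite: MochizukiFrdI2008, Cor. 5.7 (ii) p.108] -/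
theorem cor57ii_holds_of_isOfFSMType (hD₁ : IsOfFSMType D₁) (hD₂ : IsOfFSMType D₂) : Cor57ii F₁ F₂ Ψ :=
  fun hyp => cor57ii_of_cor411ii F₁ F₂ Ψ (hyp.cor411ii_of_isOfFSMType F₁ F₂ hD₁ hD₂) hyp

/-- **[FrdI] Cor. 5.7 (iii) over bases of FSM-type — no residual hypothesis** (FACT-LIST row F-0939 at the
instance family the cone cites): for `C₁`, `C₂` of model and unit-profinite type, "`Ψ` maps every
quasi-base-Frobenius pair of a Frobenius-trivial object `A₁ ∈ Ob(C₁)` to a quasi-base-Frobenius pair of a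
Frobenius-trivial object `A₂ ∈ Ob(C₂)`" — the typed `Cor57iii F₁ F₂ Ψ B₁ B₂` (SCHEMA in the birationalization
data `B₁`, `B₂`, which only enter the model-type antecedents), for every `B₁`, `B₂`.
[cite: MochizukiFrdI2008, Cor. 5.7 (iii) p.108] -/
theorem cor57iii_holds_of_isOfFSMType (B₁ : (PreFrobenioidData.ofFunctor Φ₁ F₁).BiratData)
    (B₂ : (PreFrobenioidData.ofFunctor Φ₂ F₂).BiratData) (hD₁ : IsOfFSMType D₁) (hD₂ : IsOfFSMType D₂) :
    Cor57iii F₁ F₂ Ψ B₁ B₂ := fun hyp =>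
  cor57iii_of_isOfFSMType F₁ F₂ Ψ B₁ B₂ hD₁ hD₂ (hyp.cor411ii_of_isOfFSMType F₁ F₂ hD₁ hD₂) hyp

/-- **[FrdI] Cor. 5.7 (iv) over bases of FSM-type — no residual hypothesis** (FACT-LIST row F-0940 at the
instance family the cone cites): "Suppose, moreover, when `C₁`, `C₂` are of group-like type, that both `Ψ` and
some quasi-inverse to `Ψ` preserve Frobenius degrees. Then the prefix 'quasi-' may be removed from the statements
of (i), (iii)" — the typed `Cor57iv F₁ F₂ Ψ B₁ B₂` (SCHEMA in `B₁`, `B₂`), for every `B₁`, `B₂`.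
[cite: MochizukiFrdI2008, Cor. 5.7 (iv) p.108] -/
theorem cor57iv_holds_of_isOfFSMType (B₁ : (PreFrobenioidData.ofFunctor Φ₁ F₁).BiratData)
    (B₂ : (PreFrobenioidData.ofFunctor Φ₂ F₂).BiratData) (hD₁ : IsOfFSMType D₁) (hD₂ : IsOfFSMType D₂) :
    Cor57iv F₁ F₂ Ψ B₁ B₂ := fun hyp =>
  cor57iv_of_isOfFSMType F₁ F₂ Ψ B₁ B₂ hD₁ hD₂ (hyp.cor411ii_of_isOfFSMType F₁ F₂ hD₁ hD₂) hyp

end Cor57FSMHolds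

end PreFrobenioid

end Literature.AlgebraicGeometry.Frobenioids
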